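import Summits.QuantumFields.BalabanUV.Beta.FP.OneShotSocketUnit

/-!
# `BalabanUV.Beta.FP.KktCombRowShear` — road «FP» (binder row D1): **THE COMB-ROW SHEAR OF A DOUBLY BORDERED KKT MATRIX** — adding any combination `Y·P` of the
# second row block `P` to the first row block `𝔔` is a unipotent two-sided conjugation `E·kkt H [𝔔; P]·Eᵀ`, `E := fromBlocks 1 0 0 (fromBlocks 1 Y 0 1)`; right inverses
# transfer by `E(−Y)ᵀ · X · E(−Y)`, and the `(field ⊕ 𝔔-slot)` LEG of the transferred inverse IS the leg of `X` (generic, `d`-free, [folklore] matrix algebra)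

WHY (located).  Road g57 CORR-1 ∕ A-3 (journal l.68907), after an2 g79 W-7 (l.68905): v10's one-shot sockets `hXN hLN` say that the SYM-row nested KKT matrix
`K₁ = kkt H₀ [𝔔₀; P]` has a right inverse whose leg is the σ-conjugated centred-ROOTED chart; leaf-05 `towerN_*` + leaf-02 `OneShotSocketUnit` PROVE that leg for
`K₂ = kkt H₀ [(sn n) • 𝔔♭; P]` (the rooted composite rows through the N-slot).  Since `P = bigP …` are COMB-INDICATOR rows, the two statements are reconciled exactly
when `𝔔₀ = (sn n) • 𝔔♭ + Y·P` for some `Y` — the located (C1) row junction MODULO THE COMB ROWS (`hQN′`).  This file is the generic algebra that carries right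
inverses and legs across such a shear (the converse block equation is recorded in words in CORR-1; its typing is not needed by any consumer and is left out).

WHAT ([folklore]; no `def`, no `def … : Prop`, nothing cited, 0 sorry; over `ℝ`, index types `ν κ ρ` finite with decidable equality):
§1 `shear_mul_shear_neg ∕ shear_neg_mul_shear` (`E(Y)·E(−Y) = 1 = E(−Y)·E(Y)`), `shear_transpose_mul` (`E(Y)ᵀ·E(−Y)ᵀ = 1`); §2 **`kkt_fromRows_add_mul`**
(`kkt H [Q + Y·P; P] = E(Y)·kkt H [Q; P]·E(Y)ᵀ` — Mathlib `fromBlocks_multiply ∕ fromBlocks_mul_fromRows ∕ fromBlocks_transpose`); §3 **`kkt_fromRows_add_mul_rightInverse`**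
(`kkt H [Q;P]·X = 1 ⟹ kkt H [Q + Y·P; P]·(E(−Y)ᵀ·X·E(−Y)) = 1`); §4 `shear_submatrix_leg` (the leg columns of `E(Y)` are the leg columns of `1`) and **`submatrix_leg_shear_conj`**
(`(E(Y)ᵀ·X·E(Y)).submatrix (Sum.map id inl) (Sum.map id inl) = X.submatrix (Sum.map id inl) (Sum.map id inl)`); §5 packaged for the socket's consumer:
**`rightInverse_of_shear`**, **`leg_of_shear`** (the hypotheses in leaf-02 (U12)(U13)'s shape with `hshear : 𝔔 = 𝔔b + Y·P`).

WHAT THIS IS NOT: no statement about any table of Bałaban's; the shear identity `hQN′` it will serve is a HYPOTHESIS of its consumer (road `TowerNSocketOfRow` v2), tested by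
value only (Engine C ASK-2′); nothing of Bałaban's asserted, valued or discharged; 0 estimates; 0∕4 row-D1 binders (hW, hR, D1Tel, D1Rep); NOT (C1), NOT (T-ID), NOT D1,
NEVER «G-an2-4 closed», NOT BetaPertH, NOT continuum, NOT Clay.

HONEST DEPENDENCY (page 1, mandatory): continuum YM on T⁴ ⇐ BetaPertH ∧ nine spine estimates (0/9 proved); BetaPertH ⇐ (D1) ∧ (D4) ∧ CAP+tail;
G-an2-4 gates asym, D1 and NE2/3/4.  HONEST FRAMING (cell contract, verbatim): «discharging `BetaPertH` makes Bałaban's UV stability UNCONDITIONAL —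
a real constructive-QFT result; it is NOT the continuum limit and NOT the Clay problem.»  ABSOLUTE RULE (cell charter, verbatim): «No internally-minted
statement may enter as a cited fact. Every hypothesis is either kernel-proved in this package or a verbatim quotation of a PUBLISHED theorem with page
reference. The manuscript(s) under audit are NOT citable for their own disputed steps — they are the thing under adjudication; programme-internal
(2001/route/tribunal) claims are never citable.»  Road «FP» OWNER, b2b-balaban-beta-d1-p3 gen 57, 2026-08-29.  No existing file touched.
-/

noncomputable section

open scoped BigOperators Matrix

namespace Summit.QuantumFields.BalabanUV.Beta.FP.KktCombRowShear

open Matrix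
open Literature.MathematicalPhysics.QuantumFieldTheory.Balaban1983to89.Beta.Composition (kkt)

variable {ν κ ρ : Type*} [Fintype ν] [Fintype κ] [Fintype ρ] [DecidableEq ν] [DecidableEq κ] [DecidableEq ρ]

/-! ## §1 The shear `E(Y) := fromBlocks 1 0 0 (fromBlocks 1 Y 0 1)` is unipotent: `E(Y)·E(−Y) = 1` -/

/-- [folklore] the inner shear: `[1 Y; 0 1]·[1 Y′; 0 1] = [1 (Y + Y′); 0 1]`. -/
theorem inner_shear_mul (Y Y' : Matrix κ ρ ℝ) :
    fromBlocks (1 : Matrix κ κ ℝ) Y 0 (1 : Matrix ρ ρ ℝ) * fromBlocks (1 : Matrix κ κ ℝ) Y' 0 (1 : Matrix ρ ρ ℝ)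
      = fromBlocks (1 : Matrix κ κ ℝ) (Y + Y') 0 (1 : Matrix ρ ρ ℝ) := by
  rw [fromBlocks_multiply]
  simp [add_comm]

/-- [folklore] `E(Y)·E(Y′) = E(Y + Y′)`. -/
theorem shear_mul_shear (Y Y' : Matrix κ ρ ℝ) :
    fromBlocks (1 : Matrix ν ν ℝ) 0 0 (fromBlocks (1 : Matrix κ κ ℝ) Y 0 (1 : Matrix ρ ρ ℝ))
        * fromBlocks (1 : Matrix ν ν ℝ) 0 0 (fromBlocks (1 : Matrix κ κ ℝ) Y' 0 (1 : Matrix ρ ρ ℝ))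
      = fromBlocks (1 : Matrix ν ν ℝ) 0 0 (fromBlocks (1 : Matrix κ κ ℝ) (Y + Y') 0 (1 : Matrix ρ ρ ℝ)) := by
  rw [fromBlocks_multiply, inner_shear_mul]
  simp

omit [Fintype ν] [Fintype κ] [Fintype ρ] in
/-- [folklore] `E(0) = 1`. -/
theorem shear_zero :
    fromBlocks (1 : Matrix ν ν ℝ) 0 0 (fromBlocks (1 : Matrix κ κ ℝ) (0 : Matrix κ ρ ℝ) 0 (1 : Matrix ρ ρ ℝ)) = 1 := by
  rw [fromBlocks_one, fromBlocks_one]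

/-- [folklore] `E(Y)·E(−Y) = 1`. -/
theorem shear_mul_shear_neg (Y : Matrix κ ρ ℝ) :
    fromBlocks (1 : Matrix ν ν ℝ) 0 0 (fromBlocks (1 : Matrix κ κ ℝ) Y 0 (1 : Matrix ρ ρ ℝ))
        * fromBlocks (1 : Matrix ν ν ℝ) 0 0 (fromBlocks (1 : Matrix κ κ ℝ) (-Y) 0 (1 : Matrix ρ ρ ℝ)) = 1 := by
  rw [shear_mul_shear, add_neg_cancel, shear_zero]

/-- [folklore] `E(−Y)·E(Y) = 1`. -/
theorem shear_neg_mul_shear (Y : Matrix κ ρ ℝ) :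
    fromBlocks (1 : Matrix ν ν ℝ) 0 0 (fromBlocks (1 : Matrix κ κ ℝ) (-Y) 0 (1 : Matrix ρ ρ ℝ))
        * fromBlocks (1 : Matrix ν ν ℝ) 0 0 (fromBlocks (1 : Matrix κ κ ℝ) Y 0 (1 : Matrix ρ ρ ℝ)) = 1 := by
  rw [shear_mul_shear, neg_add_cancel, shear_zero]

/-- [folklore] `E(Y)ᵀ·E(−Y)ᵀ = 1`. -/
theorem shear_transpose_mul (Y : Matrix κ ρ ℝ) :
    (fromBlocks (1 : Matrix ν ν ℝ) 0 0 (fromBlocks (1 : Matrix κ κ ℝ) Y 0 (1 : Matrix ρ ρ ℝ)))ᵀ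
        * (fromBlocks (1 : Matrix ν ν ℝ) 0 0 (fromBlocks (1 : Matrix κ κ ℝ) (-Y) 0 (1 : Matrix ρ ρ ℝ)))ᵀ = 1 := by
  rw [← Matrix.transpose_mul, shear_neg_mul_shear, transpose_one]

/-! ## §2 The shear of the doubly bordered KKT matrix -/

omit [Fintype ν] [DecidableEq ν] in
/-- [folklore] the inner shear acts on the stacked rows: `[1 Y; 0 1]·[Q; P] = [Q + Y·P; P]`. -/
theorem inner_shear_mul_fromRows (Y : Matrix κ ρ ℝ) (Q : Matrix κ ν ℝ) (P : Matrix ρ ν ℝ) :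
    fromBlocks (1 : Matrix κ κ ℝ) Y 0 (1 : Matrix ρ ρ ℝ) * fromRows Q P = fromRows (Q + Y * P) P := by
  rw [fromBlocks_mul_fromRows]
  simp

/-- [folklore] **THE COMB-ROW SHEAR**: `kkt H [Q + Y·P; P] = E(Y)·kkt H [Q; P]·E(Y)ᵀ`, `E(Y) = fromBlocks 1 0 0 (fromBlocks 1 Y 0 1)`. -/
theorem kkt_fromRows_add_mul (H : Matrix ν ν ℝ) (Q : Matrix κ ν ℝ) (P : Matrix ρ ν ℝ) (Y : Matrix κ ρ ℝ) :
    kkt H (fromRows (Q + Y * P) P)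
      = fromBlocks (1 : Matrix ν ν ℝ) 0 0 (fromBlocks (1 : Matrix κ κ ℝ) Y 0 (1 : Matrix ρ ρ ℝ)) * kkt H (fromRows Q P)
          * (fromBlocks (1 : Matrix ν ν ℝ) 0 0 (fromBlocks (1 : Matrix κ κ ℝ) Y 0 (1 : Matrix ρ ρ ℝ)))ᵀ := by
  have hT : (fromRows Q P)ᵀ * (fromBlocks (1 : Matrix κ κ ℝ) Y 0 (1 : Matrix ρ ρ ℝ))ᵀ = (fromRows (Q + Y * P) P)ᵀ := by
    rw [← Matrix.transpose_mul, inner_shear_mul_fromRows]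
  unfold kkt
  rw [fromBlocks_transpose, fromBlocks_multiply, fromBlocks_multiply]
  simp only [transpose_one, transpose_zero, Matrix.one_mul, Matrix.mul_one, Matrix.zero_mul, Matrix.mul_zero, add_zero, zero_add]
  rw [hT, inner_shear_mul_fromRows]

/-! ## §3 Right inverses transfer across the shear -/

/-- [folklore] **RIGHT-INVERSE TRANSFER**: `kkt H [Q; P]·X = 1 ⟹ kkt H [Q + Y·P; P]·(E(−Y)ᵀ·X·E(−Y)) = 1`. -/
theorem kkt_fromRows_add_mul_rightInverse (H : Matrix ν ν ℝ) (Q : Matrix κ ν ℝ) (P : Matrix ρ ν ℝ) (Y : Matrix κ ρ ℝ)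
    (X : Matrix (ν ⊕ (κ ⊕ ρ)) (ν ⊕ (κ ⊕ ρ)) ℝ) (hX : kkt H (fromRows Q P) * X = 1) :
    kkt H (fromRows (Q + Y * P) P)
        * ((fromBlocks (1 : Matrix ν ν ℝ) 0 0 (fromBlocks (1 : Matrix κ κ ℝ) (-Y) 0 (1 : Matrix ρ ρ ℝ)))ᵀ * X
            * fromBlocks (1 : Matrix ν ν ℝ) 0 0 (fromBlocks (1 : Matrix κ κ ℝ) (-Y) 0 (1 : Matrix ρ ρ ℝ))) = 1 := by
  rw [kkt_fromRows_add_mul]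
  calc fromBlocks (1 : Matrix ν ν ℝ) 0 0 (fromBlocks (1 : Matrix κ κ ℝ) Y 0 (1 : Matrix ρ ρ ℝ)) * kkt H (fromRows Q P)
          * (fromBlocks (1 : Matrix ν ν ℝ) 0 0 (fromBlocks (1 : Matrix κ κ ℝ) Y 0 (1 : Matrix ρ ρ ℝ)))ᵀ
          * ((fromBlocks (1 : Matrix ν ν ℝ) 0 0 (fromBlocks (1 : Matrix κ κ ℝ) (-Y) 0 (1 : Matrix ρ ρ ℝ)))ᵀ * X
            * fromBlocks (1 : Matrix ν ν ℝ) 0 0 (fromBlocks (1 : Matrix κ κ ℝ) (-Y) 0 (1 : Matrix ρ ρ ℝ)))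
        = fromBlocks (1 : Matrix ν ν ℝ) 0 0 (fromBlocks (1 : Matrix κ κ ℝ) Y 0 (1 : Matrix ρ ρ ℝ)) * (kkt H (fromRows Q P)
          * (((fromBlocks (1 : Matrix ν ν ℝ) 0 0 (fromBlocks (1 : Matrix κ κ ℝ) Y 0 (1 : Matrix ρ ρ ℝ)))ᵀ
              * (fromBlocks (1 : Matrix ν ν ℝ) 0 0 (fromBlocks (1 : Matrix κ κ ℝ) (-Y) 0 (1 : Matrix ρ ρ ℝ)))ᵀ) * X))
          * fromBlocks (1 : Matrix ν ν ℝ) 0 0 (fromBlocks (1 : Matrix κ κ ℝ) (-Y) 0 (1 : Matrix ρ ρ ℝ)) := by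
        simp only [Matrix.mul_assoc]
    _ = 1 := by rw [shear_transpose_mul, Matrix.one_mul, hX, Matrix.mul_one, shear_mul_shear_neg]

/-! ## §4 The leg is invariant under the shear conjugation -/

omit [Fintype ν] [Fintype κ] [Fintype ρ] in
/-- [folklore] the leg columns of `E(Y)` are the leg columns of the identity (the shear only mixes the `P`-slot into the `𝔔`-slot ROWS). -/
theorem shear_submatrix_leg (Y : Matrix κ ρ ℝ) :
    (fromBlocks (1 : Matrix ν ν ℝ) 0 0 (fromBlocks (1 : Matrix κ κ ℝ) Y 0 (1 : Matrix ρ ρ ℝ))).submatrix id (Sum.map id Sum.inl)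
      = (1 : Matrix (ν ⊕ (κ ⊕ ρ)) (ν ⊕ (κ ⊕ ρ)) ℝ).submatrix id (Sum.map id Sum.inl) := by
  ext i j
  rcases i with i | i | i <;> rcases j with j | j <;>
    simp [fromBlocks, Matrix.one_apply]

omit [Fintype ν] [Fintype κ] [Fintype ρ] in
/-- [folklore] … and so are the leg rows of `E(Y)ᵀ`. -/
theorem shear_transpose_submatrix_leg (Y : Matrix κ ρ ℝ) :
    (fromBlocks (1 : Matrix ν ν ℝ) 0 0 (fromBlocks (1 : Matrix κ κ ℝ) Y 0 (1 : Matrix ρ ρ ℝ)))ᵀ.submatrix (Sum.map id Sum.inl) id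
      = (1 : Matrix (ν ⊕ (κ ⊕ ρ)) (ν ⊕ (κ ⊕ ρ)) ℝ).submatrix (Sum.map id Sum.inl) id := by
  rw [← transpose_submatrix, shear_submatrix_leg, transpose_submatrix, transpose_one]

/-- [folklore] **LEG INVARIANCE**: `(E(Y)ᵀ·X·E(Y)).submatrix (Sum.map id inl) (Sum.map id inl) = X.submatrix (Sum.map id inl) (Sum.map id inl)`. -/
theorem submatrix_leg_shear_conj (Y : Matrix κ ρ ℝ) (X : Matrix (ν ⊕ (κ ⊕ ρ)) (ν ⊕ (κ ⊕ ρ)) ℝ) :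
    ((fromBlocks (1 : Matrix ν ν ℝ) 0 0 (fromBlocks (1 : Matrix κ κ ℝ) Y 0 (1 : Matrix ρ ρ ℝ)))ᵀ * X
        * fromBlocks (1 : Matrix ν ν ℝ) 0 0 (fromBlocks (1 : Matrix κ κ ℝ) Y 0 (1 : Matrix ρ ρ ℝ))).submatrix (Sum.map id Sum.inl) (Sum.map id Sum.inl)
      = X.submatrix (Sum.map id Sum.inl) (Sum.map id Sum.inl) := by
  rw [Matrix.submatrix_mul _ _ (Sum.map id Sum.inl) id (Sum.map id Sum.inl) Function.bijective_id,
    Matrix.submatrix_mul _ _ (Sum.map id Sum.inl) id id Function.bijective_id,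
    shear_submatrix_leg, shear_transpose_submatrix_leg,
    ← Matrix.submatrix_mul _ _ (Sum.map id Sum.inl) id id Function.bijective_id,
    ← Matrix.submatrix_mul _ _ (Sum.map id Sum.inl) id (Sum.map id Sum.inl) Function.bijective_id,
    Matrix.one_mul, Matrix.mul_one]

/-! ## §5 Packaged for the socket's consumer (leaf-02 (U12)(U13)'s shape, one shear deeper) -/

/-- [folklore] **RIGHT-INVERSE SOCKET ACROSS THE COMB-ROW SHEAR**: if `kkt H [𝔔b; P]·X = 1` and `𝔔 = 𝔔b + Y·P`, then
`kkt H [𝔔; P]·(E(−Y)ᵀ·X·E(−Y)) = 1`. -/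
theorem rightInverse_of_shear (H : Matrix ν ν ℝ) {𝔔 𝔔b : Matrix κ ν ℝ} (P : Matrix ρ ν ℝ) (Y : Matrix κ ρ ℝ) (hshear : 𝔔 = 𝔔b + Y * P)
    (X : Matrix (ν ⊕ (κ ⊕ ρ)) (ν ⊕ (κ ⊕ ρ)) ℝ) (hX : kkt H (fromRows 𝔔b P) * X = 1) :
    kkt H (fromRows 𝔔 P)
        * ((fromBlocks (1 : Matrix ν ν ℝ) 0 0 (fromBlocks (1 : Matrix κ κ ℝ) (-Y) 0 (1 : Matrix ρ ρ ℝ)))ᵀ * X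
            * fromBlocks (1 : Matrix ν ν ℝ) 0 0 (fromBlocks (1 : Matrix κ κ ℝ) (-Y) 0 (1 : Matrix ρ ρ ℝ))) = 1 := by
  subst hshear
  exact kkt_fromRows_add_mul_rightInverse H 𝔔b P Y X hX

/-- [folklore] **LEG SOCKET ACROSS THE COMB-ROW SHEAR**: the leg of `E(−Y)ᵀ·X·E(−Y)` is the leg of `X` — whatever four blocks `X`'s leg displays, the sheared inverse
displays the same. -/
theorem leg_of_shear (Y : Matrix κ ρ ℝ) (X : Matrix (ν ⊕ (κ ⊕ ρ)) (ν ⊕ (κ ⊕ ρ)) ℝ) {Lg : Matrix (ν ⊕ κ) (ν ⊕ κ) ℝ}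
    (hL : X.submatrix (Sum.map id Sum.inl) (Sum.map id Sum.inl) = Lg) :
    ((fromBlocks (1 : Matrix ν ν ℝ) 0 0 (fromBlocks (1 : Matrix κ κ ℝ) (-Y) 0 (1 : Matrix ρ ρ ℝ)))ᵀ * X
        * fromBlocks (1 : Matrix ν ν ℝ) 0 0 (fromBlocks (1 : Matrix κ κ ℝ) (-Y) 0 (1 : Matrix ρ ρ ℝ))).submatrix (Sum.map id Sum.inl) (Sum.map id Sum.inl)
      = Lg := by
  rw [submatrix_leg_shear_conj, hL]

end Summit.QuantumFields.BalabanUV.Beta.FP.KktCombRowShear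

end
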